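import Summits.MatrixMultiplication.OmegaCensus.SmallFormats.MatMul22nGF3CountCertificatePlus
import Literature.Computability.AlgebraicComplexity.MatMulM22Length3m2Frames
import HarnessLib

/-!
# ω-census family (a): the ALEKSEEV-FRAME PLANE CAP for `⟨2,2,5⟩@17` — a new clause type (any field), and the rung it opens

Cell `pub-omega` (unit `pub-omega-tensor`, gen 37), topic `Summits/MatrixMultiplication/OmegaCensus` (sub-folder
`SmallFormats`). Framing (verbatim): lottery ticket; floor = certified bounds/negative ranges. HONEST FRAMING: one new
necessary condition on the X-marginal of a length-17 bilinear algorithm for `⟨2,2,5⟩`, valid over EVERY field, and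
the conditional count-certificate rung it opens over `𝔽₃`; the certificate itself is NOT in this file.

## The clause

For every length-17 computation `XY = ∑ f_i(X) g_i(Y) W_i` of `⟨2,2,5⟩` over a field `k` and every `λ ∈ k² ∖ 0`:

  `#{i : λᵀ U_i = 0} ≤ 2`  and  `#{i : U_i λ = 0} ≤ 2`   (`U_i` = coefficient matrix of `f_i`),

where the census's X-cap system (`XCaps3`, tensor g31's clauses `32–39`) only knew `≤ 2r − 6n = 4`.

PROOF (Alekseev 2015, now in the tree): transpose the computation into one of `⟨5,2,2⟩` (`exists_trComp`:
`x y = (yᵀ xᵀ)ᵀ`); Alekseev's first blocks `D¹_t = f_t ⊗ p_t` then have `p_t =` row `0` of `U_t`. The `t` with `p_t = 0` lie outside every frame (`Frame.pvec_ne_zero`) and have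
`N_t = D_t` of rank one (`Frame.N2_eq_D2_of_D1_eq_zero`), so they are counted by `s = |R1|`; the column count
`Frame.colCount` (`2·5 ≤ s + 2(|J| − s)`) and the length-17 frame parameters `|J| ∈ {5, 6}`
(`Alekseev2015.params_522_of_card_eq_17`, p703299) give `s ≤ 2`. Other `λ`: sandwich `U_i ↦ P U_i`
(`exists_xMarginal_eq_sandwich`); columns: transpose (`exists_xMarginal_eq_transpose`).

## The rung it opens (conditional)

`eighteen_le_tensorRank_225_gf3_of_count_certificate2`: IF no count vector over tensor g31's 40 classes satisfies the
J/Q-plane clauses (cap `2`), the NEW rows/columns cap `2`, the invertible-line cap `6` (half law plus one, p681066 /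
p682596) and total `17`, THEN `18 ≤ R_𝔽₃(⟨2,2,5⟩)`, i.e. `R_𝔽₃(⟨2,2,5⟩) = 18`
(`tensorRank_225_gf3_eq_of_count_certificate2`). Desk status at filing: the LP relaxation of that system is feasible
with fractional vertices only; the integer decision is a kit item. Nothing here is a bound on `ω`.
-/

namespace Summit.MatrixMultiplication.OmegaCensus.SmallFormats

open Finset Matrix Module
open Literature.Computability.AlgebraicComplexity
open Summit.MatrixMultiplication.OmegaCensus.RankOnePlaneCapGeneral

namespace FramePlaneCap

variable {k : Type*} [Field k] {n : ℕ} {ι : Type*} [Fintype ι]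

/-- **The transposed computation** `⟨2,2,n⟩ → ⟨n,2,2⟩` exists: from `XY = ∑ f_i(X) g_i(Y) W_i` one gets
`x y = (yᵀ xᵀ)ᵀ = ∑ g_i(xᵀ) f_i(yᵀ) W_iᵀ` (Alekseev's orientation: the `2 × 2` matrix on the right), and Alekseev's
`p_t` of it is row `0` of the X-marginal: `p_t j = U_t 0 j`. (An existence statement, so that no definition is added.) -/
theorem exists_trComp (β : BilinComp (mulBilin k 2 2 n) ι) :
    ∃ β' : BilinComp (mulBilin k n 2 2) ι, ∀ t j, Alekseev2015.pvec β' t j = xMarginal β t 0 j := by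
  refine ⟨{ f := fun t => (β.g t) ∘ₗ (Matrix.transposeLinearEquiv (Fin n) (Fin 2) k k).toLinearMap,
            g := fun t => (β.f t) ∘ₗ (Matrix.transposeLinearEquiv (Fin 2) (Fin 2) k k).toLinearMap,
            w := fun t => (β.w t)ᵀ,
            map_eq_sum := fun x y => ?_ }, fun t j => ?_⟩
  · have h := β.map_eq_sum yᵀ xᵀ
    rw [mulBilin_apply] at h
    rw [mulBilin_apply, ← Matrix.transpose_transpose (x * y), Matrix.transpose_mul, h, Matrix.transpose_sum]
    refine Finset.sum_congr rfl fun t _ => ?_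
    rw [Matrix.transpose_smul, mul_comm]
    rfl
  · show β.f t (Matrix.single j 0 (1 : k))ᵀ = xMarginal β t 0 j
    rw [Matrix.transpose_single, xMarginal_apply]

/-- **The base clause (any field): at most two X-forms of a length-17 computation of `⟨2,2,5⟩` have
coefficient matrix with zero first row** (stated for any finite set `s` of such indices, so no decidability
instance enters) — they are Alekseev's type-F indices, counted by the rank-one `N_t`, and `s ≤ 2|J| − 2m ≤ 2`. -/
theorem card_le_two_of_row_zero (β : BilinComp (mulBilin k 2 2 5) ι) (hι : Fintype.card ι = 17)
    (s : Finset ι) (hs : ∀ t ∈ s, ∀ j, xMarginal β t 0 j = 0) : s.card ≤ 2 := by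
  classical
  obtain ⟨β', hβ'⟩ := exists_trComp β
  obtain ⟨F⟩ := Alekseev2015.exists_frame β'
  have hpar := Alekseev2015.params_522_of_card_eq_17 β' hι F
  have hcol := F.colCount
  have hsd : (F.J \ F.R1).card = F.J.card - F.R1.card := card_sdiff_of_subset F.R1_subset
  have hR1le : F.R1.card ≤ F.J.card := card_le_card F.R1_subset
  have hsub : s ⊆ F.R1 := by
    intro t ht
    have hp : Alekseev2015.pvec β' t = 0 := by
      funext j; rw [hβ', hs t ht j]; rfl
    have htI : t ∉ F.I := fun h => F.pvec_ne_zero h hp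
    have hD : Alekseev2015.D1 β' t = 0 := by ext x; simp [hp]
    rw [F.mem_R1]
    refine ⟨F.mem_J.2 htI, ?_⟩
    rw [F.N2_eq_D2_of_D1_eq_zero htI hD]
    exact Alekseev2015.rankLEOne_smulRight _ _
  have h4 := card_le_card hsub
  omega

/-- An invertible `2 × 2` matrix with prescribed nonzero first row. -/
private theorem exists_det_ne_zero_row (lam : Fin 2 → k) (hlam : lam ≠ 0) :
    ∃ P : Matrix (Fin 2) (Fin 2) k, P.det ≠ 0 ∧ ∀ d, P 0 d = lam d := by
  by_cases h0 : lam 0 = 0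
  · have h1 : lam 1 ≠ 0 := by
      intro h1; apply hlam; funext j; fin_cases j <;> simp [h0, h1]
    refine ⟨!![lam 0, lam 1; 1, 0], ?_, fun d => by fin_cases d <;> rfl⟩
    rw [Matrix.det_fin_two_of]; simpa [h0] using h1
  · refine ⟨!![lam 0, lam 1; 0, 1], ?_, fun d => by fin_cases d <;> rfl⟩
    rw [Matrix.det_fin_two_of]; simpa using h0

/-- **The ROW clause (any field, every direction)**: in a length-17 computation of `⟨2,2,5⟩`, for every
`λ ≠ 0`, at most two coefficient matrices have `λᵀ U_i = 0`. -/
theorem card_le_two_of_vecMul_eq_zero (β : BilinComp (mulBilin k 2 2 5) (Fin 17)) (lam : Fin 2 → k)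
    (hlam : lam ≠ 0) (s : Finset (Fin 17)) (hs : ∀ i ∈ s, Matrix.vecMul lam (xMarginal β i) = 0) :
    s.card ≤ 2 := by
  classical
  obtain ⟨P, hP, hrow⟩ := exists_det_ne_zero_row lam hlam
  obtain ⟨β', hβ'⟩ := exists_xMarginal_eq_sandwich β P 1 hP (by simp)
  refine card_le_two_of_row_zero β' (by simp) s fun i hi j => ?_
  have key : (P * xMarginal β i) 0 j = Matrix.vecMul lam (xMarginal β i) j := by
    simp only [Matrix.mul_apply, Matrix.vecMul, dotProduct, hrow]
  rw [hβ', Matrix.mul_one, key, hs i hi]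
  rfl

/-- **The COLUMN clause (any field, every direction)**: `#{i : U_i λ = 0} ≤ 2` (transpose-dual symmetry). -/
theorem card_le_two_of_mulVec_eq_zero (β : BilinComp (mulBilin k 2 2 5) (Fin 17)) (lam : Fin 2 → k)
    (hlam : lam ≠ 0) (s : Finset (Fin 17)) (hs : ∀ i ∈ s, Matrix.mulVec (xMarginal β i) lam = 0) :
    s.card ≤ 2 := by
  classical
  obtain ⟨β', hβ'⟩ := exists_xMarginal_eq_transpose β
  refine card_le_two_of_vecMul_eq_zero β' lam hlam s fun i hi => ?_
  rw [hβ', Matrix.vecMul_transpose, hs i hi]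

end FramePlaneCap

namespace Enum723

open FramePlaneCap

/-- **The new clause in census coordinates** (`𝔽₃`, tensor g31's clauses `32–39`): for the X-marginal of a
length-17 computation of `⟨2,2,5⟩` with no dead product, every rows/columns load is at most `2`. -/
theorem load_rowcol_le_two (β : BilinComp (mulBilin (ZMod 3) 2 2 5) (Fin 17))
    (hm : ∀ i, xMarginal β i ≠ 0) : ∀ kk, 32 ≤ kk → kk < 40 → load (cnt (xMarginal β)) kk ≤ 2 := by
  classical
  intro kk hk1 hk2
  rw [← card_filter_csem (xMarginal β) hm kk (by omega)]
  have h1 : ¬ kk < 32 := by omega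
  by_cases h2 : kk < 36
  · refine card_le_two_of_vecMul_eq_zero β (lamF (kk - 32)) (lamF_ne _ (by omega)) _ fun i hi => ?_
    rw [Finset.mem_filter] at hi
    have h := hi.2
    simp only [csem, if_neg h1, if_pos h2, mflat_apply] at h
    exact (vecMul_eq_zero_iff _ _).mpr h
  · have h3 : kk < 40 := hk2
    refine card_le_two_of_mulVec_eq_zero β (lamF (kk - 36)) (lamF_ne _ (by omega)) _ fun i hi => ?_
    rw [Finset.mem_filter] at hi
    have h := hi.2
    simp only [csem, if_neg h1, if_neg h2, if_pos h3, mflat_apply] at h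
    exact (mulVec_eq_zero_iff _ _).mpr h

/-- **Rung candidate `18 ≤ R_𝔽₃(⟨2,2,5⟩)` reduced to a count certificate WITH THE FRAME PLANE CAP** (`C = 6` from the
half law plus one: `2·17 < 35`, `68 ≤ 55 + 12 + 2`; rows/columns cap `2` from `load_rowcol_le_two`). The certificate
`hno` is NOT in this file. -/
theorem eighteen_le_tensorRank_225_gf3_of_count_certificate2
    (hno : ∀ c : ℕ → ℕ, (∀ k, k < 32 → load c k + 3 * 5 ≤ 17) → (∀ k, 32 ≤ k → k < 40 → load c k ≤ 2) →
      (∀ k, 40 ≤ k → k < 58 → load c k + 3 * 5 ≤ 17) → (∀ k, 58 ≤ k → k < 82 → load c k ≤ 6) → tot c = 17 → False) :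
    18 ≤ tensorRank (matMulTensor (ZMod 3) 2 2 5) := by
  classical
  have hr : 17 ≤ tensorRank (matMulTensor (ZMod 3) 2 2 5) := by
    have h := (tensorRank_matMulTensor_22n_gf3_window 5 (by norm_num)).1; omega
  refine succ_le_tensorRank_22n_of_orbit_census (k := ZMod 3) (n := 5) 17 ∅ (fun β => ?_) (by simp)
  exfalso
  have hm := xMarginal_ne_zero_of_le_tensorRank hr β
  obtain ⟨hJ, -, hQ, hL, ht⟩ := cnt_clauses (C := 6) (xMarginal β) hm (xCaps3_xMarginal β) fun X₀ hX₀ => by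
    have h := invLineCapHalfPlus_xMarginal (n := 5) (by norm_num) β X₀ hX₀; omega
  exact hno _ hJ (load_rowcol_le_two β hm) hQ hL ht

/-- **`R_𝔽₃(⟨2,2,5⟩) = 18` modulo the count certificate with the frame plane cap** (Hopcroft–Kerr upper bound in the
tree). The certificate `hno` is NOT in this file. -/
theorem tensorRank_225_gf3_eq_of_count_certificate2
    (hno : ∀ c : ℕ → ℕ, (∀ k, k < 32 → load c k + 3 * 5 ≤ 17) → (∀ k, 32 ≤ k → k < 40 → load c k ≤ 2) →
      (∀ k, 40 ≤ k → k < 58 → load c k + 3 * 5 ≤ 17) → (∀ k, 58 ≤ k → k < 82 → load c k ≤ 6) → tot c = 17 → False) :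
    tensorRank (matMulTensor (ZMod 3) 2 2 5) = 18 :=
  le_antisymm (tensorRank_matMulTensor_22n_gf3_window 5 (by norm_num)).2
    (eighteen_le_tensorRank_225_gf3_of_count_certificate2 hno)

end Enum723

/-! ## Appendix (tensor g37, later the same day): the clause at every length `3m + 2`, `m ≥ 5` (any field)

The argument above uses `m = 5` only through `Alekseev2015.params_522_of_card_eq_17`; with `Frame.params_of_card_eq`
(`|J| ∈ {m, m+1}` at length `3m + 2`, `m ≥ 5`) it runs verbatim for every `m ≥ 5`: in a length-`(3m+2)` bilinear algorithm for
`⟨2,2,m⟩`, at most TWO X-forms have coefficient matrix in any given rank-one row/column plane. (Over `𝔽₃` the cells `(m, 3m+2)`,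
`m ≥ 6`, lie below the Alekseev–Nazarov floor; over `𝔽₄`, `𝔽₅`, `𝔽₇` the corresponding class-count systems keep integer points
— kit GO #145/#146 — so this general form is structure, not a rung.) -/

namespace FramePlaneCap

variable {k : Type*} [Field k] {ι : Type*} [Fintype ι]

/-- **The base clause at length `3m + 2`, `m ≥ 5` (any field)**: at most two X-forms of a length-`(3m+2)` computation of `⟨2,2,m⟩`
have coefficient matrix with zero first row. -/
theorem card_le_two_of_row_zero_general {m : ℕ} (hm : 5 ≤ m) (β : BilinComp (mulBilin k 2 2 m) ι)
    (hι : Fintype.card ι = 3 * m + 2) (s : Finset ι) (hs : ∀ t ∈ s, ∀ j, xMarginal β t 0 j = 0) : s.card ≤ 2 := by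
  classical
  obtain ⟨β', hβ'⟩ := exists_trComp β
  obtain ⟨F⟩ := Alekseev2015.exists_frame β'
  have hpar := F.params_of_card_eq hm hι
  have hcol := F.colCount
  have hsd : (F.J \ F.R1).card = F.J.card - F.R1.card := card_sdiff_of_subset F.R1_subset
  have hR1le : F.R1.card ≤ F.J.card := card_le_card F.R1_subset
  have hsub : s ⊆ F.R1 := by
    intro t ht
    have hp : Alekseev2015.pvec β' t = 0 := by
      funext j; rw [hβ', hs t ht j]; rfl
    have htI : t ∉ F.I := fun h => F.pvec_ne_zero h hp
    have hD : Alekseev2015.D1 β' t = 0 := by ext x; simp [hp]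
    rw [F.mem_R1]
    refine ⟨F.mem_J.2 htI, ?_⟩
    rw [F.N2_eq_D2_of_D1_eq_zero htI hD]
    exact Alekseev2015.rankLEOne_smulRight _ _
  have h4 := card_le_card hsub
  omega

/-- **The ROW clause at length `3m + 2`, `m ≥ 5` (any field, every direction)**: `#{i : λᵀ U_i = 0} ≤ 2`. -/
theorem card_le_two_of_vecMul_eq_zero_general {m : ℕ} (hm : 5 ≤ m) (β : BilinComp (mulBilin k 2 2 m) ι)
    (hι : Fintype.card ι = 3 * m + 2) (lam : Fin 2 → k) (hlam : lam ≠ 0) (s : Finset ι)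
    (hs : ∀ i ∈ s, Matrix.vecMul lam (xMarginal β i) = 0) : s.card ≤ 2 := by
  classical
  obtain ⟨P, hP, hrow⟩ := exists_det_ne_zero_row lam hlam
  obtain ⟨β', hβ'⟩ := exists_xMarginal_eq_sandwich β P 1 hP (by simp)
  refine card_le_two_of_row_zero_general hm β' hι s fun i hi j => ?_
  have key : (P * xMarginal β i) 0 j = Matrix.vecMul lam (xMarginal β i) j := by
    simp only [Matrix.mul_apply, Matrix.vecMul, dotProduct, hrow]
  rw [hβ', Matrix.mul_one, key, hs i hi]
  rfl

/-- **The COLUMN clause at length `3m + 2`, `m ≥ 5` (any field, every direction)**: `#{i : U_i λ = 0} ≤ 2`. -/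
theorem card_le_two_of_mulVec_eq_zero_general {m : ℕ} (hm : 5 ≤ m) (β : BilinComp (mulBilin k 2 2 m) ι)
    (hι : Fintype.card ι = 3 * m + 2) (lam : Fin 2 → k) (hlam : lam ≠ 0) (s : Finset ι)
    (hs : ∀ i ∈ s, Matrix.mulVec (xMarginal β i) lam = 0) : s.card ≤ 2 := by
  classical
  obtain ⟨β', hβ'⟩ := exists_xMarginal_eq_transpose β
  refine card_le_two_of_vecMul_eq_zero_general hm β' hι lam hlam s fun i hi => ?_
  rw [hβ', Matrix.vecMul_transpose, hs i hi]

end FramePlaneCap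

end Summit.MatrixMultiplication.OmegaCensus.SmallFormats
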